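import Summits.QuantumFields.BalabanUV.T4Continuum.Support.RegionInteriorGaffney

/-!
# T⁴ programme, spine node NE2 (U1a), sub-row Δ1 «NE2⁰-Dirichlet» — THE ELECTRIC BOUNDARY CONDITION AS AN OPERATOR IDENTITY:
# `curlRᴴ·curlR + gradR·gradRᴴ = Σ_μ W_μ`, `W_μ = Idiff_μᴴ·Idiff_μ + n²·diag(transverse charges)` under `AtMostOneNeighbour`
# (own direction NEUMANN — interior differences only —, transverse directions DIRICHLET — zero extension)

NE2 formalisation swarm `b2b-balaban-t4-ne2-formalise-*`, LEAF PROVER 02 (gen 8), supplier item «Δ1-LOC-HESS» = owner ruling R34 (b)'s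
(R-hess-interior) re-targeted per owner g15's O15-a (W-a) to the LOCAL operator `Δ_loc = curlRᴴcurlR + gradR·gradRᴴ + a n^d·avgRᴴavgR`
(«whose H² is corner-free SCALAR business»), file 1 of 2 (file 2 `Support/RegionElectricHessian`: the corner-free H² of `Σ_μ W_μ` on
product regions).  THIS FILE turns the two QUADRATIC-FORM statements of the leaf-07 lineage — gen 6's lattice Gaffney identity of a region
`RegionGaffneyIdentity.gaffney_region` (`‖curlR A‖² + ‖gradRᴴA‖² + extFlux A = Σ_ν ‖∇_ν ιA‖²`, p228054) and gen 7's boundary-charge split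
`RegionStarBoundaryCharges.sum_nsq_fdiff_ext_eq` (`Σ_ν ‖∇_ν ιA‖² = Σ_ν ‖igrad_ν A‖² + n²·Σ_b cntR(b)‖A b‖²`, p231674) — into OPERATOR
identities on the star bonds `V = {b // starReg n M S b}` (polarization, `B5Action121.ext_of_form_eq`):

 * §1 `Idiff μ` — THE MATRIX of the interior difference `DirichletStarRenormTower.igrad` (`Idiff_mulVec`); the per-direction boundary charge
   `cnt1 μ b = [b + e_μ ∉ V] + [b − e_μ ∉ V]` (`cntR = Σ_μ cnt1 μ`, definitional); the transverse charge `tcnt μ b = [b.2 ≠ μ]·cnt1 μ b`;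
   **`Wdir μ := (Idiff μ)ᴴ·Idiff μ + diag(n²·tcnt μ)`** and its form `re⟨A, W_μ A⟩ = ‖igrad_μ A‖² + n²·Σ_b tcnt μ b·‖A b‖²`.
 * §2 ANY region: **`toBlock_fdiff_sq`** `((∇_μ)ᴴ∇_μ)_{VV} = (Idiff μ)ᴴ·Idiff μ + n²·diag(cnt1 μ)` (operator form of `nsq_fdiff_ext_eq`).
 * §3 under H1 = `AtMostOneNeighbour` (every product region at `n ≥ 2`, `atMostOneNeighbour_of_isCoordBox`): the exterior endpoints of a
   star bond are EXACTLY its non-star own-direction translates (`not_star_sub_iff`, `not_star_add_iff`), the exterior divergence is fed by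
   at most one bond, with EQUALITY (`divS_ext_sq_eq`), hence **`extFlux_eq`**: `extFlux A = n²·Σ_b cnt1 (b.2) b·‖A b‖²` — the exterior
   flux IS the own-direction charge (gen 7's `extFlux_le` with equality and the sharp charge).
 * §4 THE END **`electric_splitting (hH : AtMostOneNeighbour n M S) : (curlR)ᴴ·curlR + gradR·(gradR)ᴴ = Σ_μ Wdir μ`** (+ `_box`):
   the local part of the [B9]-faithful `Δ_a(Ω₀)` (`RegionGaugeFixedVector.regionDeltaA` minus its gauge-projection and mass summands) is,
   direction by direction, the NEUMANN second difference along a bond's own direction (no charge: the own-direction jumps of the zero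
   extension cancel EXACTLY against the exterior flux) plus the DIRICHLET second difference of the zero extension across the transverse
   directions — the lattice «electric boundary condition» (tangential components vanish outside, normal components free) made explicit;
   `form_electric` is its quadratic form `‖curlR A‖² + ‖gradRᴴA‖² = Σ_μ (‖igrad_μ A‖² + n²·Σ_b tcnt μ b‖A b‖²)` (sharpens gen 7's
   `interior_gaffney`, which drops the transverse charges).

HONEST FRAMING (T4-DAG p. 1).  Lattice calculus at MODEL level (`U = 1`, ONE region, finite torus); statements OURS ([folklore]); nothing
printed is a hypothesis; re-entrant unions are NOT covered by §3–§4; W3 on boxes OPEN; Δ1 NOT closed; NE2 (U1a) NOT proved; spine PROVED 0/9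
unchanged; NOT [B9] (3.16)/(3.23)–(3.27) as printed; NOT infinite volume, NOT a mass gap, NOT the Clay problem.  HONEST DEPENDENCY: continuum YM
on T⁴ ⇐ BetaPertH ∧ nine spine estimates (0/9 proved); BetaPertH ⇐ (D1) ∧ (D4) ∧ CAP+tail; G-an2-4 gates asym, D1 and NE2/3/4.  No `sorry`.
-/

noncomputable section

open scoped BigOperators ComplexConjugate Matrix Matrix.Norms.L2Operator
open Finset

namespace Summit.QuantumFields.BalabanUV.T4Continuum.RegionElectricSplitting

open Literature.MathematicalPhysics.QuantumFieldTheory.Balaban1983to89.B5Prop11Plancherel (Tor fine fdiff unitVec)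
open Literature.MathematicalPhysics.QuantumFieldTheory.Balaban1983to89.B5Prop11Lower (nsq nsq_nonneg Lap)
open Literature.MathematicalPhysics.QuantumFieldTheory.Balaban1983to89.B5Action121 (GradOp divS divS_apply GradOp_conjTranspose_mulVec_eq
  ext_of_form_eq)
open Summit.QuantumFields.BalabanUV.T4Continuum
open Summit.QuantumFields.BalabanUV.T4Continuum.SubtypeCompression (ext ext_apply_of ext_apply_of_not form_toBlock)
open Summit.QuantumFields.BalabanUV.T4Continuum.RegionGaugeSlice (form_gram)
open Summit.QuantumFields.BalabanUV.T4Continuum.RegionGaugeFixedVector (starReg curlR gradR)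
open Summit.QuantumFields.BalabanUV.T4Continuum.DirichletStarRenormTower (igrad)
open Summit.QuantumFields.BalabanUV.T4Continuum.RegionGaffneyIdentity (extFlux gaffney_region)
open Summit.QuantumFields.BalabanUV.T4Continuum.RegionStarBoundaryCharges (nbr AtMostOneNeighbour cntR sum_nsq_fdiff_ext_eq nsq_fdiff_ext_eq
  atMostOneNeighbour_of_isCoordBox)
open Summit.QuantumFields.BalabanUV.T4Continuum.RegionInteriorGaffney (sum_tail_eq sum_head_eq)
open Summit.QuantumFields.BalabanUV.Beta.GAN24.DirichletBoxTrace (blockReg)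
open Summit.QuantumFields.BalabanUV.Beta.GAN24.DirichletBoxTwoLevel (IsCoordBox)

variable {d : ℕ}

/-! ## §0 An elementary lemma -/

/-- the form of a real diagonal matrix: `⟨A, diag(c) A⟩ = Σ_b c_b·‖A b‖²`. [folklore] -/
theorem form_diagonal_ofReal {m : Type*} [Fintype m] [DecidableEq m] (c : m → ℝ) (A : m → ℂ) :
    star A ⬝ᵥ (Matrix.diagonal (fun b => ((c b : ℝ) : ℂ)) *ᵥ A) = ((∑ b, c b * ‖A b‖ ^ 2 : ℝ) : ℂ) := by
  rw [Complex.ofReal_sum]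
  unfold dotProduct
  refine sum_congr rfl fun b _ => ?_
  rw [Matrix.mulVec_diagonal, Pi.star_apply, Complex.ofReal_mul, Complex.ofReal_pow, ← Complex.conj_mul', Complex.star_def]
  ring

section Region

variable (n : ℕ) [NeZero n] (M : Fin d → ℕ) [hM : ∀ μ, NeZero (M μ)] (S : Tor M → Prop) [DecidablePred S]

/-! ## §1 The interior difference as a matrix, the directional charges, the directional operators -/

/-- **THE MATRIX OF `igrad_μ`** on the star bonds: row `b` reads `n·(w(b + e_μ) − w(b))` when `b + e_μ` is a star bond, `0` otherwise.
[folklore] -/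
def Idiff (μ : Fin d) : Matrix {b // starReg n M S b} {b // starReg n M S b} ℂ := fun y b' =>
  if h : starReg n M S (y.1.1 + unitVec (fine n M) μ, y.1.2) then
    (n : ℂ) * ((if b' = ⟨(y.1.1 + unitVec (fine n M) μ, y.1.2), h⟩ then 1 else 0) - (if b' = y then 1 else 0))
  else 0

/-- `Idiff μ` acts as `igrad_μ`. [folklore] -/
theorem Idiff_mulVec (μ : Fin d) (w : {b // starReg n M S b} → ℂ) : Idiff n M S μ *ᵥ w = igrad M S n μ w := by
  funext y
  unfold Idiff igrad
  simp only [Matrix.mulVec, dotProduct]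
  by_cases h : starReg n M S (y.1.1 + unitVec (fine n M) μ, y.1.2)
  · simp only [dif_pos h, mul_sub, sub_mul, sum_sub_distrib, mul_assoc, ite_mul, one_mul, zero_mul, ← mul_sum, sum_ite_eq', mem_univ,
      if_true]
  · simp only [dif_neg h, zero_mul, sum_const_zero]

/-- THE PER-DIRECTION BOUNDARY CHARGE of a bond: `[b + e_μ not star] + [b − e_μ not star]` (so that `cntR = Σ_μ cnt1 μ`). [folklore] -/
def cnt1 (μ : Fin d) (b : Tor (fine n M) × Fin d) : ℝ :=
  (if starReg n M S (b.1 + unitVec (fine n M) μ, b.2) then (0 : ℝ) else 1)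
    + (if starReg n M S (b.1 - unitVec (fine n M) μ, b.2) then (0 : ℝ) else 1)

/-- `cntR b = Σ_μ cnt1 μ b` (definitional). [folklore] -/
theorem cntR_eq_sum_cnt1 (b : Tor (fine n M) × Fin d) : cntR n M S b = ∑ μ, cnt1 n M S μ b := rfl

/-- `0 ≤ cnt1`. [folklore] -/
theorem cnt1_nonneg (μ : Fin d) (b : Tor (fine n M) × Fin d) : 0 ≤ cnt1 n M S μ b := by
  unfold cnt1
  exact add_nonneg (by split_ifs <;> norm_num) (by split_ifs <;> norm_num)

/-- THE TRANSVERSE CHARGE: the per-direction charge in the directions transverse to the bond, `0` in its own direction. [folklore] -/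
def tcnt (μ : Fin d) (b : Tor (fine n M) × Fin d) : ℝ := if b.2 = μ then 0 else cnt1 n M S μ b

/-- `0 ≤ tcnt`. [folklore] -/
theorem tcnt_nonneg (μ : Fin d) (b : Tor (fine n M) × Fin d) : 0 ≤ tcnt n M S μ b := by
  unfold tcnt; split_ifs
  · exact le_rfl
  · exact cnt1_nonneg n M S μ b

/-- `Σ_μ tcnt μ b = cntR b − cnt1 (b.2) b`: the transverse charges are all charges but the own-direction one. [folklore] -/
theorem sum_tcnt_eq (b : Tor (fine n M) × Fin d) : ∑ μ, tcnt n M S μ b = cntR n M S b - cnt1 n M S b.2 b := by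
  have h : ∀ μ, tcnt n M S μ b = cnt1 n M S μ b - (if b.2 = μ then cnt1 n M S μ b else 0) := by
    intro μ
    unfold tcnt
    split_ifs with h1
    · subst h1; ring
    · ring
  simp_rw [h, sum_sub_distrib, Finset.sum_ite_eq, mem_univ, if_true, cntR_eq_sum_cnt1]

/-- **THE DIRECTIONAL OPERATOR `W_μ = (Idiff μ)ᴴ·Idiff μ + n²·diag(tcnt μ)`**: the Neumann second difference along the own direction of
each bond (`tcnt = 0` there), the Dirichlet (zero-extension) second difference along the transverse directions. [folklore] -/
def Wdir (μ : Fin d) : Matrix {b // starReg n M S b} {b // starReg n M S b} ℂ :=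
  (Idiff n M S μ)ᴴ * Idiff n M S μ + Matrix.diagonal (fun b => (((n : ℝ) ^ 2 * tcnt n M S μ b.1 : ℝ) : ℂ))

/-- the form of `W_μ`: `⟨A, W_μ A⟩ = ‖igrad_μ A‖² + n²·Σ_b tcnt μ b·‖A b‖²`. [folklore] -/
theorem form_Wdir (μ : Fin d) (A : {b // starReg n M S b} → ℂ) :
    star A ⬝ᵥ (Wdir n M S μ *ᵥ A)
      = ((nsq (igrad M S n μ A) + (n : ℝ) ^ 2 * ∑ b : {b // starReg n M S b}, tcnt n M S μ b.1 * ‖A b‖ ^ 2 : ℝ) : ℂ) := by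
  unfold Wdir
  rw [Matrix.add_mulVec, dotProduct_add, form_gram, Idiff_mulVec,
    form_diagonal_ofReal (fun b : {b // starReg n M S b} => (n : ℝ) ^ 2 * tcnt n M S μ b.1) A, ← Complex.ofReal_add, mul_sum]
  congr 1
  refine congrArg _ (sum_congr rfl fun b _ => ?_)
  ring

/-- `W_μ` is Hermitian. [folklore] -/
theorem Wdir_isHermitian (μ : Fin d) : (Wdir n M S μ).IsHermitian := by
  unfold Wdir
  refine (Matrix.isHermitian_conjTranspose_mul_self _).add ?_
  exact Matrix.isHermitian_diagonal_iff.mpr fun b => by simp [isSelfAdjoint_iff]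

/-- the form of `W_μ` is nonnegative. [folklore] -/
theorem form_Wdir_nonneg (μ : Fin d) (A : {b // starReg n M S b} → ℂ) : 0 ≤ (star A ⬝ᵥ (Wdir n M S μ *ᵥ A)).re := by
  rw [form_Wdir, Complex.ofReal_re]
  have := nsq_nonneg (igrad M S n μ A)
  have : 0 ≤ ∑ b : {b // starReg n M S b}, tcnt n M S μ b.1 * ‖A b‖ ^ 2 :=
    sum_nonneg fun b _ => mul_nonneg (tcnt_nonneg n M S μ b.1) (sq_nonneg _)
  positivity

/-! ## §2 Any region: the compressed one-direction Laplacian is the interior one plus the directional charge -/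

/-- **`((∇_μ)ᴴ∇_μ)_{VV} = (Idiff μ)ᴴ·Idiff μ + n²·diag(cnt1 μ)`** on the star bonds of ANY union of blocks (operator form of
`nsq_fdiff_ext_eq`). [folklore] -/
theorem toBlock_fdiff_sq (μ : Fin d) :
    ((fdiff (fine n M) (n : ℂ) μ)ᴴ * fdiff (fine n M) (n : ℂ) μ).toBlock (starReg n M S) (starReg n M S)
      = (Idiff n M S μ)ᴴ * Idiff n M S μ + Matrix.diagonal (fun b => (((n : ℝ) ^ 2 * cnt1 n M S μ b.1 : ℝ) : ℂ)) := by
  refine ext_of_form_eq fun A => ?_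
  rw [form_toBlock, form_gram, nsq_fdiff_ext_eq, Matrix.add_mulVec, dotProduct_add, form_gram, Idiff_mulVec,
    form_diagonal_ofReal (fun b : {b // starReg n M S b} => (n : ℝ) ^ 2 * cnt1 n M S μ b.1) A, ← Complex.ofReal_add, mul_sum]
  congr 1
  refine congrArg _ (sum_congr rfl fun b _ => ?_)
  unfold cnt1
  split_ifs <;> ring

/-! ## §3 Under H1: the exterior flux is exactly the own-direction charge -/

omit [DecidablePred S] in
/-- under H1, the backward own-direction translate of a star bond fails to be a star bond EXACTLY when its tail is outside `Ω`.
[folklore] -/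
theorem not_star_sub_iff (hH : AtMostOneNeighbour n M S) (y : {b // starReg n M S b}) :
    ¬ starReg n M S (y.1.1 - unitVec (fine n M) y.1.2, y.1.2) ↔ ¬ blockReg n M S y.1.1 := by
  obtain ⟨⟨x, ν⟩, hy⟩ := y
  constructor
  · intro hns hx
    exact hns (Or.inr (by simpa using hx))
  · intro hx
    have hz : blockReg n M S (x + unitVec (fine n M) ν) := hy.resolve_left hx
    rintro (h1 | h2)
    · have := hH x hx (ν, true) (ν, false) (by simpa [nbr] using hz) (by simpa [nbr] using h1)
      simp at this
    · simp only [sub_add_cancel] at h2; exact hx h2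

omit [DecidablePred S] in
/-- under H1, the forward own-direction translate of a star bond fails to be a star bond EXACTLY when its head is outside `Ω`.
[folklore] -/
theorem not_star_add_iff (hH : AtMostOneNeighbour n M S) (y : {b // starReg n M S b}) :
    ¬ starReg n M S (y.1.1 + unitVec (fine n M) y.1.2, y.1.2) ↔ ¬ blockReg n M S (y.1.1 + unitVec (fine n M) y.1.2) := by
  obtain ⟨⟨x, ν⟩, hy⟩ := y
  constructor
  · intro hns hz
    exact hns (Or.inl (by simpa using hz))
  · intro hz
    have hx : blockReg n M S x := hy.resolve_right hz
    rintro (h1 | h2)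
    · exact hz h1
    · have := hH (x + unitVec (fine n M) ν) hz (ν, false) (ν, true) (by simpa [nbr] using hx) (by simpa [nbr] using h2)
      simp at this

/-- hence under H1 the own-direction charge of a star bond counts its exterior endpoints:
`cnt1 (b.2) b = [head ∉ Ω] + [tail ∉ Ω]`. [folklore] -/
theorem cnt1_own_eq (hH : AtMostOneNeighbour n M S) (y : {b // starReg n M S b}) :
    cnt1 n M S y.1.2 y.1 = (if blockReg n M S (y.1.1 + unitVec (fine n M) y.1.2) then (0 : ℝ) else 1)
      + (if blockReg n M S y.1.1 then (0 : ℝ) else 1) := by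
  unfold cnt1
  have h1 := not_star_add_iff n M S hH y
  have h2 := not_star_sub_iff n M S hH y
  congr 1
  · by_cases hz : blockReg n M S (y.1.1 + unitVec (fine n M) y.1.2)
    · rw [if_pos hz, if_pos (not_not.mp (mt h1.mp (not_not.mpr hz)))]
    · rw [if_neg hz, if_neg (h1.mpr hz)]
  · by_cases hx : blockReg n M S y.1.1
    · rw [if_pos hx, if_pos (not_not.mp (mt h2.mp (not_not.mpr hx)))]
    · rw [if_neg hx, if_neg (h2.mpr hx)]

/-- under H1 the exterior divergence at a site outside `Ω` is fed by at most one bond, WITH EQUALITY: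
`‖(∂ᴴιA)(x)‖² = n²·Σ_μ (‖ιA(x − e_μ, μ)‖² + ‖ιA(x, μ)‖²)`. [folklore] -/
theorem divS_ext_sq_eq (hH : AtMostOneNeighbour n M S) (A : {b // starReg n M S b} → ℂ) {x : Tor (fine n M)}
    (hx : ¬ blockReg n M S x) :
    ‖divS (fine n M) (n : ℂ) (ext (starReg n M S) A) x‖ ^ 2
      = (n : ℝ) ^ 2 * ∑ μ, (‖ext (starReg n M S) A (x - unitVec (fine n M) μ, μ)‖ ^ 2 + ‖ext (starReg n M S) A (x, μ)‖ ^ 2) := by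
  set w : Fin d × Bool → ℂ := fun i =>
    if i.2 then -((n : ℂ) * ext (starReg n M S) A (x, i.1)) else (n : ℂ) * ext (starReg n M S) A (x - unitVec (fine n M) i.1, i.1)
    with hw
  have hsum : divS (fine n M) (n : ℂ) (ext (starReg n M S) A) x = ∑ i, w i := by
    rw [divS_apply, Fintype.sum_prod_type]
    refine sum_congr rfl fun μ _ => ?_
    rw [Fintype.sum_bool]
    simp only [hw, if_true, Bool.false_eq_true, if_false, Complex.conj_natCast]
    ring
  have hnz : ∀ i, w i ≠ 0 → blockReg n M S (nbr n M x i) := by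
    rintro ⟨μ, b⟩ hi
    cases b
    · simp only [hw, Bool.false_eq_true, if_false] at hi
      have h' : ext (starReg n M S) A (x - unitVec (fine n M) μ, μ) ≠ 0 := fun h0 => hi (by rw [h0, mul_zero])
      have hs : starReg n M S (x - unitVec (fine n M) μ, μ) := by
        by_contra hs; exact h' (ext_apply_of_not _ _ hs)
      rcases hs with h1 | h2
      · simpa [nbr] using h1
      · simp only [sub_add_cancel] at h2; exact absurd h2 hx
    · simp only [hw, if_true] at hi
      have h' : ext (starReg n M S) A (x, μ) ≠ 0 := fun h0 => hi (by rw [h0, mul_zero, neg_zero])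
      have hs : starReg n M S (x, μ) := by
        by_contra hs; exact h' (ext_apply_of_not _ _ hs)
      rcases hs with h1 | h2
      · exact absurd h1 hx
      · simpa [nbr] using h2
  have hpair : ∀ i j, i ≠ j → w i = 0 ∨ w j = 0 := by
    intro i j hij
    by_contra hc
    rw [not_or] at hc
    exact hij (hH x hx i j (hnz i hc.1) (hnz j hc.2))
  -- at most one term is non-zero, so `‖Σ w‖² = Σ ‖w‖²` (equality form of gen 7's `norm_sum_sq_le_of_pairwise`)
  have heq : ‖∑ i, w i‖ ^ 2 = ∑ i, ‖w i‖ ^ 2 := by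
    by_cases hex : ∃ i, w i ≠ 0
    · obtain ⟨i₀, hi₀⟩ := hex
      have hz : ∀ j ∈ (univ : Finset (Fin d × Bool)), j ≠ i₀ → w j = 0 := fun j _ hj => (hpair j i₀ hj).resolve_right hi₀
      rw [sum_eq_single i₀ hz (fun hh => absurd (mem_univ _) hh),
        sum_eq_single i₀ (fun j hj hne => by rw [hz j hj hne, norm_zero, zero_pow two_ne_zero]) (fun hh => absurd (mem_univ _) hh)]
    · push Not at hex
      simp [hex]
  rw [hsum, heq, Fintype.sum_prod_type, mul_sum]
  refine sum_congr rfl fun μ _ => ?_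
  rw [Fintype.sum_bool]
  simp only [hw, if_true, Bool.false_eq_true, if_false, norm_neg, norm_mul, Complex.norm_natCast, mul_pow]
  ring

/-- **THE EXTERIOR FLUX UNDER H1 IS THE OWN-DIRECTION CHARGE**: `extFlux A = n²·Σ_{b star} cnt1 (b.2) b·‖A b‖²` (gen 7's `extFlux_le`
with equality and the sharp charge). [folklore] -/
theorem extFlux_eq (hH : AtMostOneNeighbour n M S) (A : {b // starReg n M S b} → ℂ) :
    extFlux n M S A = (n : ℝ) ^ 2 * ∑ y : {b // starReg n M S b}, cnt1 n M S y.1.2 y.1 * ‖A y‖ ^ 2 := by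
  unfold extFlux
  rw [GradOp_conjTranspose_mulVec_eq]
  calc ∑ x : {x // ¬ blockReg n M S x}, ‖divS (fine n M) (n : ℂ) (ext (starReg n M S) A) x‖ ^ 2
      = ∑ x : {x // ¬ blockReg n M S x}, (n : ℝ) ^ 2 *
          ∑ μ, (‖ext (starReg n M S) A (x.1 - unitVec (fine n M) μ, μ)‖ ^ 2 + ‖ext (starReg n M S) A (x.1, μ)‖ ^ 2) :=
        sum_congr rfl fun x _ => divS_ext_sq_eq n M S hH A x.2
    _ = (n : ℝ) ^ 2 * ∑ y : {b // starReg n M S b},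
          ((if blockReg n M S (y.1.1 + unitVec (fine n M) y.1.2) then (0 : ℝ) else ‖A y‖ ^ 2)
            + (if blockReg n M S y.1.1 then (0 : ℝ) else ‖A y‖ ^ 2)) := by
        rw [← mul_sum, sum_congr rfl fun x _ => sum_add_distrib, sum_add_distrib, sum_head_eq, sum_tail_eq, ← sum_add_distrib]
    _ = (n : ℝ) ^ 2 * ∑ y : {b // starReg n M S b}, cnt1 n M S y.1.2 y.1 * ‖A y‖ ^ 2 := by
        congr 1
        refine sum_congr rfl fun y _ => ?_
        rw [cnt1_own_eq n M S hH y]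
        split_ifs <;> ring

/-! ## §4 The END: the electric splitting -/

/-- the form of the local electric operator: `⟨A, (curlRᴴcurlR + gradR·gradRᴴ)A⟩ = ‖curlR A‖² + ‖gradRᴴA‖²`. [folklore] -/
theorem form_curl_add_div (A : {b // starReg n M S b} → ℂ) :
    star A ⬝ᵥ (((curlR n M S)ᴴ * curlR n M S + gradR n M S * (gradR n M S)ᴴ) *ᵥ A)
      = ((nsq (curlR n M S *ᵥ A) + nsq ((gradR n M S)ᴴ *ᵥ A) : ℝ) : ℂ) := by
  rw [Matrix.add_mulVec, dotProduct_add, form_gram]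
  conv_lhs => rw [← Matrix.conjTranspose_conjTranspose (gradR n M S)]
  rw [Matrix.conjTranspose_conjTranspose ((gradR n M S)ᴴ), form_gram, Complex.ofReal_add]

/-- **THE ELECTRIC FORM UNDER H1**: `‖curlR A‖² + ‖gradRᴴA‖² = Σ_μ (‖igrad_μ A‖² + n²·Σ_b tcnt μ b·‖A b‖²)` — interior differences plus
the TRANSVERSE charges only (sharpens `RegionInteriorGaffney.interior_gaffney`). [folklore] -/
theorem form_electric (hH : AtMostOneNeighbour n M S) (A : {b // starReg n M S b} → ℂ) :
    nsq (curlR n M S *ᵥ A) + nsq ((gradR n M S)ᴴ *ᵥ A)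
      = ∑ μ, (nsq (igrad M S n μ A) + (n : ℝ) ^ 2 * ∑ b : {b // starReg n M S b}, tcnt n M S μ b.1 * ‖A b‖ ^ 2) := by
  have h1 := gaffney_region n M S A
  rw [sum_nsq_fdiff_ext_eq, extFlux_eq n M S hH] at h1
  have h2 : ∑ μ, (nsq (igrad M S n μ A) + (n : ℝ) ^ 2 * ∑ b : {b // starReg n M S b}, tcnt n M S μ b.1 * ‖A b‖ ^ 2)
      = ∑ μ, nsq (igrad M S n μ A) + (n : ℝ) ^ 2 * ∑ b : {b // starReg n M S b}, (cntR n M S b.1 - cnt1 n M S b.1.2 b.1) * ‖A b‖ ^ 2 := by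
    rw [sum_add_distrib, ← mul_sum, sum_comm]
    congr 2
    refine sum_congr rfl fun b _ => ?_
    rw [← sum_mul, sum_tcnt_eq]
  rw [h2]
  have h3 : ∑ b : {b // starReg n M S b}, (cntR n M S b.1 - cnt1 n M S b.1.2 b.1) * ‖A b‖ ^ 2
      = ∑ b : {b // starReg n M S b}, cntR n M S b.1 * ‖A b‖ ^ 2 - ∑ b : {b // starReg n M S b}, cnt1 n M S b.1.2 b.1 * ‖A b‖ ^ 2 := by
    rw [← sum_sub_distrib]; exact sum_congr rfl fun b _ => by ring
  rw [h3]
  linarith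

/-- **THE ELECTRIC SPLITTING** (H1): `curlRᴴ·curlR + gradR·gradRᴴ = Σ_μ W_μ` as OPERATORS on the star bonds — own direction Neumann,
transverse directions Dirichlet. [folklore] -/
theorem electric_splitting (hH : AtMostOneNeighbour n M S) :
    (curlR n M S)ᴴ * curlR n M S + gradR n M S * (gradR n M S)ᴴ = ∑ μ, Wdir n M S μ := by
  refine ext_of_form_eq fun A => ?_
  rw [form_curl_add_div, form_electric n M S hH, Matrix.sum_mulVec, dotProduct_sum, Complex.ofReal_sum]
  exact sum_congr rfl fun μ _ => (form_Wdir n M S μ A).symm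

/-- **THE ELECTRIC SPLITTING ON PRODUCT REGIONS** (every `IsCoordBox`, every level `n ≥ 2`). [folklore] -/
theorem electric_splitting_box (hn : 2 ≤ n) (hS : IsCoordBox M S) :
    (curlR n M S)ᴴ * curlR n M S + gradR n M S * (gradR n M S)ᴴ = ∑ μ, Wdir n M S μ :=
  electric_splitting n M S (atMostOneNeighbour_of_isCoordBox n M S hn hS)

end Region

end Summit.QuantumFields.BalabanUV.T4Continuum.RegionElectricSplitting

end
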